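import Summits.QuantumFields.YangMills.Theorems.BalabanLadderIRColdPurityBridgeRungs
import Summits.QuantumFields.YangMills.Theorems.BalabanLadderIRDefectSquaringSharp
import Summits.QuantumFields.YangMills.Theorems.BalabanLadderIRColdDefectContinuous
import Summits.QuantumFields.YangMills.Theorems.BalabanLadderIRCouplingAxisTransport
import Summits.QuantumFields.YangMills.Theorems.BalabanLadderIRCouplingDerivative
import Summits.QuantumFields.YangMills.Theorems.BalabanLadderIRAbstractBasinRung24
import Summits.QuantumFields.YangMills.Theorems.BalabanLadderIRCouplingLipschitzStrongCoupling
import HarnessLib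

/-!
# Crux `IR` (stmt-QuantumFields-19354) — line `lipschitz-chain` (ideator ym-ir-idea-12 g0, lens «wuc», line 2)

SKELETON (rev 8: K1 `ExitsUnboundedAt (1/24)` over idea-9's landed ladder top p604479; rev 7: LIP's rung PROVED, landed p605254).  Target BY NAME: `Summit.QuantumFields.YangMills.Theses.BalabanLadder.IR`.

HONESTY.  Nothing here proves the Yang–Mills mass gap (Clay), the crux `IR`, or the seed `E`; R4 closes only the
conditional finite-𝕋⁴ rung `BalabanLadder.UV`.  CONDITIONAL REDUCTION: four registered stubs (`stub_exitsUnbounded` K1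
— the SAME statement as line `coupling-clopen`'s K1 and, up to `max(·,2)`, as `thermal-ratchet`'s `CofinalCertificateSC`;
`stub_defectLipschitz` LIP — NEW; and BY NAME the tokens `stub_afPin : AFToColdPressure` (X), `stub_irnsc : IRnsc` (N));
everything else kernel-checked: `allExit_of_lipschitz` (a FINITE CHAIN along the coupling axis), `eventuallyPure_of_exit`
(explicit sharp R: `AspectBootstrap.coldDefect_sq_le_two_pow`, constant `2²⁰`, + `defect_decay_of_recursion`), `onsetSC_of_allExit` (tree seam),
`IR_of` (tree pincer `IR_of_cp_repaired`).

THE CUT (variation of `coupling-clopen` after self-diagnosis: there the inter-coupling content was K2 = «no bulk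
criticality» in PURITY-LENGTH currency (plus continuity S, PROVED there in rev 3), glued by topology; a critic can object
that K2's common purification scale is invisible to any instrument — a purity defect `≤ 2⁻²⁴` is below Monte-Carlo resolution).  Here the transport is
METRIC and lives in ENERGY currency:
* (LIP) `DefectLipschitzSC`: beyond `β₁`, on every compact coupling range `[u, v]`, the purity defects
  `b ↦ δᶜ_b(L)` are UNIFORMLY LIPSCHITZ in the coupling for all scales `L ≥ L₁(u,v)` (the cold tail):
  `|δᶜ_b(L) − δᶜ_{b'}(L)| ≤ M·|b − b'|`.  Since `∂_β log[Z_β(L³×2t)/Z_β(L³×t)²] = −(⟨S⟩_{β,L³×2t} − 2⟨S⟩_{β,L³×t})`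
  (`S` = total Wilson action), LIP is implied by ACTION ADDITIVITY UNDER TIME DOUBLING: `|⟨S⟩_{2t} − 2⟨S⟩_t| ≤ M`
  tail-uniformly — a finite-size statement about the MEAN PLAQUETTE (`= 3L⁴·|⟨s_p⟩_{L³×L/2} − ⟨s_p⟩_{L³×L/4}|`), i.e.
  hyperscaling-size finite-size corrections of the energy density.  TRUE in massive phases (`O(L⁴e^{−mL/4})`), TRUE in
  massless phases (Stefan–Boltzmann: `O(1)`, e.g. `U(1)₄` Coulomb, free fields), FALSE exactly at bulk critical or
  coexistence couplings (`|Δ⟨s_p⟩| ∼ L^{1/ν−4}` resp. `O(1)`): LIP is «no bulk criticality beyond β₁» in the currency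
  engines measure daily, with NO SIGN hypothesis (contrast `thermal-ratchet`'s monotonicity M) and no continuity stub.
* (K1) `ExitsUnboundedSC`: exiting couplings are unbounded (the Yang–Mills content, subsequence form; shared).
COMPOSITION (PROVED, `allExit_of_lipschitz`): an exit at `b₁` gives, by the explicit R-decay, a tail scale `P ≥ L₁` with
`δᶜ_{b₁}(P) ≤ exitTol/2` (`eventuallyPure_of_exit`); LIP at scale `P` makes every coupling within `r = exitTol/(2M)` of
`b₁` exit — a propagation radius INDEPENDENT of `b₁` and of the (geometrically growing) scales; a finite chain of
`⌈(b₀ − β)/r⌉` steps from an exiting `b₀ ≥ β + 1` (K1) reaches `β`.  No topology, no continuity, no common scale.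
Honest strength: LIP ∧ K1 ⇒ K2 ∧ E (mod R) — rev 4: `exitScaleTame_of_lipschitz` PROVES LIP ∧ K1 ⇒ K2 in this file over the LANDED
transports (p602902) and LIP's instrument identity is the LANDED `hasDerivAt_log_coldRatio` (p602873); LIP is formally STRONGER than K2 but
weaker than any rate/sign law in β (`thermal-ratchet`'s M, `beta-slope-floor`'s slope floor, the withdrawn thermal
transport): it asks for a bounded modulus, not a sign and not a decay.

RUNGS (PROVED, group-blind): `exits_strongCoupling` — K1's body on the whole window `[0, r_ρ]`; and (rev 7) LIP's BODY on every
compact window `[u, v] ⊂ [0, r_ρ)` with the explicit modulus `(1 + e)/(r_ρ − v)`, UNIFORMLY in `L ≥ L₁(ρ)` —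
`defectLipschitz_strongCoupling_rung`, a wrapper over the LANDED `CouplingAxis.coldDefect_lipschitz_strongCoupling`
(Theorems/BalabanLadderIRCouplingLipschitzStrongCoupling.lean): analyticity in the COMPLEX coupling (the tree's Kotecký–Preiss tube rate
`exists_tube_rate` ⇒ the cold ratio `Z_z(2m)/Z_z(m)²` is zero-free and bounded by `e` on the disc `‖z‖ ≤ r_ρ` for `L ≥ L₁`, Cauchy estimate,
mean value inequality).  So LIP = «the window's Lipschitz regularity of the purity defect, continued past `β₁` along the real axis»; what is
lost at weak coupling is the zero-free COMPLEX neighbourhood (deconfinement Fisher zeros of the `4:1` tori pinch the real axis) — LIP asks only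
for the real-axis modulus, not for the disc.  CHEAPEST FALSIFIER / INSTRUMENT «ACTION-ADDITIVITY» (ask ym-ir-eng-2): `A(β,L) := 3L⁴(⟨s_p⟩_{L³×L/2} − ⟨s_p⟩_{L³×L/4})`
for SU(2) Wilson at `β ∈ {2.2, 2.3}`, `L ∈ {16, 24, 32}` (cold tail: `L/4 > N_{t,c}(β)`): `|A|` must DECREASE with `L`
(massive) — growth `∝ L^{1/ν}` or an `L`-independent plateau growing with β-resolution signals bulk criticality and kills
LIP for that range; control `U(1)₄` at `β = 1.2` (Coulomb): plateau `A → 3c_SB ≠ 0` (allowed by LIP — LIP is abelian-true;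
the abelian failure sits in K1).
-/

set_option autoImplicit false

noncomputable section

open Filter Topology MeasureTheory
open scoped SchwartzMap
open Literature.MathematicalPhysics.QuantumFieldTheory Literature.MathematicalPhysics.QuantumLattice
open Literature.MathematicalPhysics.QuantumFieldTheory.Balaban1983to89.Missing (strongCouplingRadius
  strongCouplingRadius_pos)
open Summit.QuantumFields.YangMills.Cruxes.IR.ColdPressurePincer
open Summit.QuantumFields.YangMills.Cruxes.IR.ColdPurityBridge (coldDefect coldPressureAt_of_exit_recursion
  coldExit_uniform_of_strongCoupling)
open Summit.QuantumFields.YangMills.Cruxes.IR.AspectBootstrap (coldDefect_sq_le_two_pow)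
open Summit.QuantumFields.YangMills.Theorems.DoublingDefect (coldDefect_nonneg defect_decay_of_recursion)

namespace Summit.QuantumFields.YangMills.Cruxes.IR.LipschitzChain

/-! ## §1 The per-coupling predicate «β exits» (verbatim as in line `coupling-clopen`) -/

/-- The exit tolerance of the PROVED (sharp) recursion: `1/(16·max(2²⁰, 2)) = 2⁻²⁴`. -/
def exitTol : ℝ := 1 / (16 * max (2 ^ 20 : ℝ) 2)

/-- `exitTol = 2⁻²⁴` (the sharp basin threshold `ε⋆` of `AspectBootstrap.coldDefect_sq_le_two_pow`, shared with lines
`basin-transfer` ∕ `fss-handover` ∕ `thermal-ratchet`). -/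
theorem exitTol_eq : exitTol = 1 / 2 ^ 24 := by
  rw [exitTol, max_eq_left (by norm_num : (2 : ℝ) ≤ 2 ^ 20)]; norm_num

/-- `0 < 2²⁰` (the sharp squaring constant is positive). -/
theorem two_pow_twenty_pos : (0 : ℝ) < 2 ^ 20 := by norm_num

/-- `exitTol > 0`. -/
theorem exitTol_pos : 0 < exitTol := by
  unfold exitTol
  have : 0 < max (2 ^ 20 : ℝ) 2 := lt_max_of_lt_right (by norm_num)
  positivity

section Defs

variable {G : Type} [Group G] [TopologicalSpace G] [IsTopologicalGroup G] [CompactSpace G]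
  [MeasurableSpace G] [BorelSpace G]

/-- **«coupling `β` exits»**: some cold torus `L³ × ⌊L/4⌋`, `L ≥ 8`, is `exitTol`-pure at coupling `β`
(verbatim `CouplingClopen.Exits`). -/
def Exits {N : ℕ} (ρ : G →* Matrix (Fin N) (Fin N) ℂ) (β : ℝ) : Prop :=
  ∃ L : ℕ, 8 ≤ L ∧ coldDefect ρ β L ≤ exitTol

end Defs

/-! ## §2 The stub statements -/

/-- **(K1) `ExitsUnboundedSC` — exiting couplings are unbounded** (crux; verbatim line `coupling-clopen` K1; equal up to
`max(·,2)` to `thermal-ratchet`'s `CofinalCertificateSC`).  Why it might fail: a massless ∕ deconfined weak-coupling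
phase; FALSE for `U(1)₄`, for `π₁(G) ≠ 1`, for finite `G`.  Sources: Luscher1977; OsterwalderSeilerAnnPhys1978 §3;
Guth1980; FrohlichSpencer1982; tHooft1979; `Literature.Barriers.QuantumFields.AbelianDeconfinementD4`. -/
def ExitsUnboundedSC : Prop :=
  ∀ (G : Type) [Group G] [TopologicalSpace G] [IsTopologicalGroup G] [CompactSpace G],
    IsCompactSimpleLieGroup G → SimplyConnectedSpace G →
    letI : MeasurableSpace G := borel G
    haveI : BorelSpace G := ⟨rfl⟩
    ∀ r : LatticeRep G, ∀ β₁ : ℝ, ∃ β : ℝ, β₁ ≤ β ∧ Exits r.ρ β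

/-- **(K1♭, rev 5–6) `ExitsUnboundedAt θ` — exiting couplings are unbounded AT TOLERANCE `θ`** (the registered K1 is `θ = 1/24` since rev 8 — the top of the LANDED abstract ladder `1/24 → 2⁻⁶ → 2⁻⁸ → 2⁻⁹ → 2⁻²⁴` (p604479); verbatim the
K1♭ of line `coupling-clopen` rev 6).  At `θ = exitTol = 2⁻²⁴` this is `ExitsUnboundedSC` (`exitsUnboundedAt_exitTol_iff`); for every `θ ≤ 1/24` it
IMPLIES `ExitsUnboundedSC` at the SAME couplings by ideator idea-9's LANDED group-free ladder `BasinRung.abstractBasin_24_epsStar :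
AbstractBasin (1/24) 2⁻²⁴` (p604479 ∘ p603750 ∘ p603051; transport parametric in the rung) — basin transport changes the scale, never the coupling, so it commutes
with «cofinally in β».  Seed of record per instance: ONE inequality `Z_β(L³×2m) ≥ (23/24)·Z_β(L³×m)²` (≈ 4.2 % purity defect).
Why it might fail / sources: as `ExitsUnboundedSC`. -/
def ExitsUnboundedAt (θ : ℝ) : Prop :=
  ∀ (G : Type) [Group G] [TopologicalSpace G] [IsTopologicalGroup G] [CompactSpace G],
    IsCompactSimpleLieGroup G → SimplyConnectedSpace G →
    letI : MeasurableSpace G := borel G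
    haveI : BorelSpace G := ⟨rfl⟩
    ∀ r : LatticeRep G, ∀ β₁ : ℝ, ∃ β : ℝ, β₁ ≤ β ∧ ∃ L : ℕ, 8 ≤ L ∧ coldDefect r.ρ β L ≤ θ

theorem exitsUnboundedAt_exitTol_iff : ExitsUnboundedAt exitTol ↔ ExitsUnboundedSC := Iff.rfl

theorem exitsUnboundedAt_mono {θ θ' : ℝ} (h : θ ≤ θ') (hK : ExitsUnboundedAt θ) : ExitsUnboundedAt θ' := by
  intro G _ _ _ _ hG hsc
  letI : MeasurableSpace G := borel G
  haveI : BorelSpace G := ⟨rfl⟩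
  intro r β₁
  obtain ⟨β, hβ, L, hL, hδ⟩ := hK G hG hsc r β₁
  exact ⟨β, hβ, L, hL, hδ.trans h⟩

section BasinTransport

variable {G : Type} [Group G] [TopologicalSpace G] [IsTopologicalGroup G] [CompactSpace G]
  [MeasurableSpace G] [BorelSpace G]

/-- **Per-coupling basin transport, parametric in the abstract rung:** if `AbstractBasin θ ε⋆` holds (group-free; LANDED for `θ = 1/24` by
idea-9's `BasinRung.abstractBasin_24_epsStar`, p604479 ∘ p603750 ∘ p603051), then at `β ≥ 0` a `θ`-pure cold torus of side `≥ 8` forces an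
`exitTol = 2⁻²⁴`-pure one of (another) side `≥ 8` — Wilson's theory is an axis-symmetric trace-positive family with volume bounds
(`AspectBootstrap.axisSymmetric ∕ tracePositive ∕ volumeBounds`, `coldDefect_eq_boxDefect`).  The transport moves the SCALE, never the COUPLING. -/
theorem exits_of_exitAt (r : LatticeRep G) {θ : ℝ} (hA : BasinRung.AbstractBasin θ BasinRung.epsStar) {β : ℝ} (hβ0 : 0 ≤ β)
    {L : ℕ} (hL : 8 ≤ L) (h : coldDefect r.ρ β L ≤ θ) : Exits r.ρ β := by
  rw [AspectBootstrap.coldDefect_eq_boxDefect] at h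
  obtain ⟨L', hL', h'⟩ := hA _ (AspectBootstrap.axisSymmetric r β)
    (AspectBootstrap.tracePositive r hβ0) (AspectBootstrap.volumeBounds r hβ0) L hL h
  refine ⟨L', hL', ?_⟩
  rw [AspectBootstrap.coldDefect_eq_boxDefect, exitTol_eq, ← BasinRung.epsStar_eq]
  exact h'

end BasinTransport

/-- **K1♭(θ) ⇒ K1 whenever the abstract basin reaches `θ` (PROVED, parametric):** plug any landed `AbstractBasin θ ε⋆`. -/
theorem exitsUnboundedSC_of_basin {θ : ℝ} (hA : BasinRung.AbstractBasin θ BasinRung.epsStar) (hK : ExitsUnboundedAt θ) :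
    ExitsUnboundedSC := by
  intro G _ _ _ _ hG hsc
  letI : MeasurableSpace G := borel G
  haveI : BorelSpace G := ⟨rfl⟩
  intro r β₁
  obtain ⟨β, hβ, L, hL, hδ⟩ := hK G hG hsc r (max β₁ 0)
  exact ⟨β, le_trans (le_max_left _ _) hβ, exits_of_exitAt r hA (le_trans (le_max_right _ _) hβ) hL hδ⟩

/-- **K1♭(θ) ⇒ K1 for every `θ ≤ 1/24`** (the abstract ladder of record `1/24 → 2⁻⁶ → 2⁻⁸ → 2⁻⁹ → 2⁻²⁴`, idea-9 ∕ idea-13, all LANDED; top rung p604479). -/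
theorem exitsUnboundedSC_of_at {θ : ℝ} (hθ : θ ≤ 1 / 24) (hK : ExitsUnboundedAt θ) : ExitsUnboundedSC :=
  exitsUnboundedSC_of_basin BasinRung.abstractBasin_24_epsStar (exitsUnboundedAt_mono hθ hK)


/-- **(LIP) `DefectLipschitzSC` — tail-uniform Lipschitz continuity of the purity defect in the coupling (crux, NEW).**
For compact simple simply-connected `G` and every `r` there is `β₁` such that on every compact coupling range
`[u, v] ⊂ (β₁, ∞)` some modulus `M > 0` and tail `L₁` give `|δᶜ_b(L) − δᶜ_{b'}(L)| ≤ M·|b − b'|` for all `L ≥ L₁` and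
`b, b' ∈ [u, v]`.  Implied by ACTION ADDITIVITY `|⟨S⟩_{b,L³×2t} − 2⟨S⟩_{b,L³×t}| ≤ M` (derivative identity), i.e. by
`O(L⁻⁴)` finite-size corrections of the mean plaquette between the `4:1` and `2:1` cold tori.  Abelian-TRUE (Coulomb
phase: Stefan–Boltzmann `O(1)`); fails exactly at bulk critical ∕ coexistence couplings, absorbed by `∃ β₁`.
Why it might fail: bulk transitions of the `(G, r)` Wilson action accumulating at `β = ∞`; or a cold-tail finite-size
anomaly of the energy density larger than hyperscaling (`|Δ⟨s_p⟩| ≫ L⁻⁴`) at non-critical couplings (unknown in any model).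
Sources: Creutz1980 ∕ Creutz 2022 pp.101,116 (SU(2) crossover, no singularity on the Wilson axis); BhanotCreutz1981;
EngelsKarschMontvaySatz1982 (NPB 205: plaquette finite-size ∕ finite-temperature differences); Boyd et al. hep-lat/9602007;
LuciniTeperWenger hep-lat/0502003; BorgsKotecky1990 (coexistence FSS, why `β₁`). -/
def DefectLipschitzSC : Prop :=
  ∀ (G : Type) [Group G] [TopologicalSpace G] [IsTopologicalGroup G] [CompactSpace G],
    IsCompactSimpleLieGroup G → SimplyConnectedSpace G →
    letI : MeasurableSpace G := borel G
    haveI : BorelSpace G := ⟨rfl⟩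
    ∀ r : LatticeRep G, ∃ β₁ : ℝ, ∀ u v : ℝ, β₁ < u → u ≤ v →
      ∃ M : ℝ, ∃ L₁ : ℕ, 0 < M ∧ ∀ L : ℕ, L₁ ≤ L → ∀ b b' : ℝ, u ≤ b → b ≤ v → u ≤ b' → b' ≤ v →
        |coldDefect r.ρ b L - coldDefect r.ρ b' L| ≤ M * |b - b'|

/-! ## §3 Registered stubs (sorries live ONLY here) -/

/-- stub **K1** (crux, rank 2, shared), rev 6 re-based on idea-9's landed ladder: `ExitsUnboundedAt (1/2^6)` — the seed at tolerance
`1/24 ≈ 4.2 %` cofinally in `β` (rev 8: top rung p604479; ⇒ `ExitsUnboundedSC` by `exitsUnboundedSC_of_at`). OPEN (body PROVED on `[0, r_ρ]`: `exitsAt_strongCoupling`). -/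
theorem stub_exitsUnbounded : ExitsUnboundedAt (1 / 24) := by
  sorry

/-- stub **LIP** (crux, rank 3 — structural, energy currency): `DefectLipschitzSC`. OPEN beyond the window (body PROVED on every compact
window of `[0, r_ρ)`, uniformly in the volume: `defectLipschitz_strongCoupling_rung`, rev 7). -/
theorem stub_defectLipschitz : DefectLipschitzSC := by
  sorry

/-- stub **X** (token of record, BY NAME): `ColdPressurePincer.AFToColdPressure`. -/
theorem stub_afPin : AFToColdPressure := by
  sorry

/-- stub **N** (RESIDUAL of record, BY NAME): `ColdPressurePincer.IRnsc`. -/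
theorem stub_irnsc : IRnsc := by
  sorry

/-! ## §4 PROVED: exits are eventually pure (explicit R); the Lipschitz chain; onset; `IR` -/

section Decay

variable {G : Type} [Group G] [TopologicalSpace G] [IsTopologicalGroup G] [CompactSpace G]
  [MeasurableSpace G] [BorelSpace G]

/-- **An exit is eventually pure at every tolerance** — LANDED (p602902 `CouplingAxis.eventuallyPure_of_exit`, sharp tolerance
`2⁻²⁴ = exitTol`); restated here over `exitTol`. -/
theorem eventuallyPure_of_exit (r : LatticeRep G) {β : ℝ} (hβ0 : 0 ≤ β) {L : ℕ} (hL8 : 8 ≤ L)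
    (hex : coldDefect r.ρ β L ≤ exitTol) {ε : ℝ} (hε : 0 < ε) (L₁ : ℕ) :
    ∃ P : ℕ, L₁ ≤ P ∧ 8 ≤ P ∧ coldDefect r.ρ β P ≤ ε :=
  CouplingAxis.eventuallyPure_of_exit r hβ0 hL8 (by rw [← exitTol_eq]; exact hex) hε L₁

/-- **LIP's instrument is a tree identity (rev 4):** `β ↦ δᶜ_β(L)` is differentiable (`CouplingAxis.differentiable_coldDefect`,
p602873) and `d/dβ log[Z_β(L³×2m)/Z_β(L³×m)²] = −(⟨S⟩_{2m} − 2⟨S⟩_m)` (`CouplingAxis.hasDerivAt_log_coldRatio`): the Lipschitz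
modulus of LIP is a bound on the ACTION-ADDITIVITY defect under time doubling (restated pointer, no new content). -/
theorem differentiable_coldDefect' (r : LatticeRep G) (L : ℕ) :
    Differentiable ℝ fun β : ℝ => coldDefect r.ρ β L :=
  CouplingAxis.differentiable_coldDefect r L

end Decay

/-- «every coupling beyond some `β₁` exits» (verbatim line `coupling-clopen`). -/
def AllExitSC : Prop :=
  ∀ (G : Type) [Group G] [TopologicalSpace G] [IsTopologicalGroup G] [CompactSpace G],
    IsCompactSimpleLieGroup G → SimplyConnectedSpace G →
    letI : MeasurableSpace G := borel G
    haveI : BorelSpace G := ⟨rfl⟩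
    ∀ r : LatticeRep G, ∃ β₁ : ℝ, ∀ β : ℝ, β₁ < β → Exits r.ρ β

/-- **The Lipschitz chain (REAL proof).**  K1 ∧ LIP ⇒ every coupling beyond `max β₁ 0` exits: from an exiting
`b₀ ≥ β + 1` (K1), the uniform modulus `M` of LIP on `[β, b₀]` and the tail purity `δᶜ ≤ exitTol/2` of every exit
(`eventuallyPure_of_exit`) give a propagation radius `r = exitTol/(2M)` independent of the coupling; induct. -/
theorem allExit_of_lipschitz (hK1 : ExitsUnboundedSC) (hLip : DefectLipschitzSC) : AllExitSC := by
  -- rev 4: the finite chain is LANDED (p602902 `CouplingAxis.allExit_of_lipschitz`, per representation, tolerance 2⁻²⁴).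
  intro G _ _ _ _ hG hsc
  letI : MeasurableSpace G := borel G
  haveI : BorelSpace G := ⟨rfl⟩
  intro r
  obtain ⟨β₁, hT⟩ := hLip G hG hsc r
  refine ⟨max β₁ 0, fun β hβ => ?_⟩
  have hK1' : ∀ b : ℝ, ∃ β : ℝ, b ≤ β ∧ ∃ L : ℕ, 8 ≤ L ∧ coldDefect r.ρ β L ≤ 1 / 2 ^ 24 := fun b => by
    rw [← exitTol_eq]; exact hK1 G hG hsc r b
  have hLip' := fun u v (hu : max β₁ 0 < u) (huv : u ≤ v) => hT u v (lt_of_le_of_lt (le_max_left _ _) hu) huv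
  have h := CouplingAxis.allExit_of_lipschitz r (le_max_right β₁ 0) hK1' hLip' β hβ
  rw [← exitTol_eq] at h
  exact h

/-- **(K2 of line `coupling-clopen`, verbatim) `ExitScaleTameSC`** — one common purifying scale on every compact coupling range
beyond `β₁` (filed by line 1; restated here so that the family lattice `LIP ∧ K1 ⇒ K2` is a kernel fact of this file). -/
def ExitScaleTameSC : Prop :=
  ∀ (G : Type) [Group G] [TopologicalSpace G] [IsTopologicalGroup G] [CompactSpace G],
    IsCompactSimpleLieGroup G → SimplyConnectedSpace G →
    letI : MeasurableSpace G := borel G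
    haveI : BorelSpace G := ⟨rfl⟩
    ∀ r : LatticeRep G, ∃ β₁ : ℝ, ∀ u v : ℝ, β₁ < u → u ≤ v →
      ∃ P : ℕ, 8 ≤ P ∧ ∀ β : ℝ, u ≤ β → β ≤ v → Exits r.ρ β → coldDefect r.ρ β P ≤ exitTol / 2

/-- **LIP ∧ K1 ⇒ K2 (PROVED; the family lattice of the coupling-axis transports).**  All exit (`allExit_of_lipschitz`), then the
LANDED compactness theorem `CouplingAxis.exitScaleTame_of_allExit` gives one common purifying scale per compact range. -/
theorem exitScaleTame_of_lipschitz (hK1 : ExitsUnboundedSC) (hLip : DefectLipschitzSC) : ExitScaleTameSC := by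
  intro G _ _ _ _ hG hsc
  letI : MeasurableSpace G := borel G
  haveI : BorelSpace G := ⟨rfl⟩
  intro r
  obtain ⟨β₁, hex⟩ := allExit_of_lipschitz hK1 hLip G hG hsc r
  refine ⟨max β₁ 0, fun u v hu huv => ?_⟩
  have hAll : ∀ β : ℝ, max β₁ 0 < β → ∃ L : ℕ, 8 ≤ L ∧ coldDefect r.ρ β L ≤ 1 / 2 ^ 24 := fun β hβ => by
    rw [← exitTol_eq]; exact hex β (lt_of_le_of_lt (le_max_left _ _) hβ)
  obtain ⟨P, hP8, hP⟩ := CouplingAxis.exitScaleTame_of_allExit r (le_max_right β₁ 0) hAll (half_pos exitTol_pos)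
    u v hu huv
  exact ⟨P, hP8, fun β hβu hβv _ => hP β hβu hβv⟩

/-- «all exit» is the landed single-tolerance seed `BasinRung.ColdExitAt ε⋆` (idea-9). -/
theorem coldExitAt_of_allExit (h : AllExitSC) : BasinRung.ColdExitAt BasinRung.epsStar := by
  intro G _ _ _ _ hG hsc
  letI : MeasurableSpace G := borel G
  haveI : BorelSpace G := ⟨rfl⟩
  intro r
  obtain ⟨β₁, hex⟩ := h G hG hsc r
  refine ⟨β₁ + 1, fun β hβ => ?_⟩
  obtain ⟨L, hL8, hδ⟩ := hex β (by linarith)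
  exact ⟨L, hL8, by rw [BasinRung.epsStar_eq, ← exitTol_eq]; exact hδ⟩

/-- **Every exit is a cold-pressure length** — BY NAME: `BasinRung.coldPressureOnsetSC_of_exitAt` (landed). -/
theorem onsetSC_of_allExit (h : AllExitSC) : ColdPressureOnsetSC :=
  BasinRung.coldPressureOnsetSC_of_exitAt (coldExitAt_of_allExit h)

/-- **The line concludes the crux `IR` BY NAME** from K1♭ (`1/24`), LIP and the tokens X, N: K1♭ ⇒ K1 (landed basin ladder); K1 ∧ LIP ⇒ all exit
(finite chain, landed) ⇒ `ColdExitAt ε⋆` ⇒ `IR` (`BasinRung.IR_of_exitAt`, landed pincer of record). -/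
theorem IR_of (hK1 : ExitsUnboundedAt (1 / 24)) (hLip : DefectLipschitzSC) (hX : AFToColdPressure) (hN : IRnsc) :
    Summit.QuantumFields.YangMills.Theses.BalabanLadder.IR :=
  BasinRung.IR_of_exitAt (coldExitAt_of_allExit (allExit_of_lipschitz (exitsUnboundedSC_of_at le_rfl hK1) hLip)) hX hN

/-- **Proof-of-item shape**: the crux from the four registered stubs (K1 at `1/24`, rev 8). -/
theorem IR_of_stubs : Summit.QuantumFields.YangMills.Theses.BalabanLadder.IR :=
  IR_of stub_exitsUnbounded stub_defectLipschitz stub_afPin stub_irnsc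

/-! ## §5 Rungs (PROVED, group-blind): K1's body on the strong-coupling window `[0, r_ρ]`; LIP's body on its compact sub-windows -/

section Rungs

variable {G : Type} [Group G] [TopologicalSpace G] [IsTopologicalGroup G] [CompactSpace G]
  [MeasurableSpace G] [BorelSpace G]

/-- **RUNG for K1 (PROVED): every coupling of the strong-coupling window exits** (compact `G`, any `r`). -/
theorem exits_strongCoupling (r : LatticeRep G) {β : ℝ} (hβ0 : 0 ≤ β) (hβ : β ≤ strongCouplingRadius r.ρ) :
    Exits r.ρ β := by
  obtain ⟨k₁, hk₁, h⟩ := coldExit_uniform_of_strongCoupling r exitTol_pos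
  exact ⟨8 * k₁, by omega, h β hβ0 hβ k₁ le_rfl⟩

/-- **RUNG for K1♭ (PROVED):** every coupling of the strong-coupling window exits at tolerance `1/24` (indeed at `2⁻²⁵`). -/
theorem exitsAt_strongCoupling (r : LatticeRep G) {β : ℝ} (hβ0 : 0 ≤ β) (hβ : β ≤ strongCouplingRadius r.ρ) :
    ∃ L : ℕ, 8 ≤ L ∧ coldDefect r.ρ β L ≤ 1 / 24 := by
  obtain ⟨L, hL8, h⟩ := exits_strongCoupling r hβ0 hβ
  exact ⟨L, hL8, h.trans (by rw [exitTol_eq]; norm_num)⟩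

/-- **RUNG for LIP (PROVED, rev 7; LANDED as `CouplingAxis.defectLipschitz_strongCoupling`):** LIP's body — a volume-uniform Lipschitz
modulus of `β ↦ δᶜ_β(L)` — on every compact window `[u, v] ⊂ [0, r_ρ)` (compact `G`, any `r`; modulus `(1+e)/(r_ρ − v)`). -/
theorem defectLipschitz_strongCoupling_rung (r : LatticeRep G) (u v : ℝ) (hu : 0 ≤ u) (huv : u ≤ v)
    (hv : v < strongCouplingRadius r.ρ) :
    ∃ M : ℝ, ∃ L₁ : ℕ, 0 < M ∧ ∀ L : ℕ, L₁ ≤ L → ∀ b b' : ℝ, u ≤ b → b ≤ v → u ≤ b' → b' ≤ v →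
      |coldDefect r.ρ b L - coldDefect r.ρ b' L| ≤ M * |b - b'| :=
  CouplingAxis.defectLipschitz_strongCoupling r u v hu huv hv

/-- **The explicit form (PROVED, LANDED as `CouplingAxis.coldDefect_lipschitz_strongCoupling`):** one threshold `L₁(ρ) ≥ 8` for all windows and
the modulus `(1 + e)/(r_ρ − v)`. -/
theorem coldDefect_lipschitz_strongCoupling_rung (r : LatticeRep G) :
    ∃ L₁ : ℕ, 8 ≤ L₁ ∧ ∀ u v : ℝ, 0 ≤ u → u ≤ v → v < strongCouplingRadius r.ρ →
      ∀ L : ℕ, L₁ ≤ L → ∀ b b' : ℝ, u ≤ b → b ≤ v → u ≤ b' → b' ≤ v →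
        |coldDefect r.ρ b L - coldDefect r.ρ b' L| ≤
          (1 + Real.exp 1) / (strongCouplingRadius r.ρ - v) * |b - b'| :=
  CouplingAxis.coldDefect_lipschitz_strongCoupling r

end Rungs

end Summit.QuantumFields.YangMills.Cruxes.IR.LipschitzChain

end
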